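import Summits.Ventures.PercRepro.RankLevelSetDepCountGen
import Summits.Ventures.PercRepro.RankLevelSetLevelFive
import Summits.Ventures.PercRepro.RankLevelSetDepCountGiantB2
import Summits.Ventures.PercRepro.RankLevelSetLevelFiveGiant
import Summits.Ventures.PercRepro.RankLevelSetLevelSplitAll
import Summits.Ventures.PercRepro.S1TriangleCount
import Summits.Ventures.PercRepro.S1FourCircuitCount
import Summits.Ventures.PercRepro.RankLevelSetPlaneTenPrime
import Summits.Ventures.PercRepro.RankLevelSetCorankFiveCounts
import Summits.Ventures.PercRepro.S2FlatTail
import Summits.Ventures.PercRepro.S2SetCountQ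
import Summits.Ventures.PercRepro.S2SetCountQI
import Summits.Ventures.PercRepro.S2IndepFiveCount
import Summits.Ventures.PercRepro.S1TrianglePlusSharp
import Summits.Ventures.PercRepro.S1CoreFourCircuitSum

/-!
# PercRepro — S2: THE TOP COUNT AT LEVEL `5` WITH THE INDEPENDENT `5`-SETS CORRECTED BY THE TRIANGLES, THE TRIANGLE AND `4`-CIRCUIT COUNTS PARAMETERS (p7, gen 7; sub-claim S2; the `p = 19` row)

S2SharpTopXQIC's `topCount_le_sharp_xqic` word for word, with the triangle bound T⁺⁺⁺ = `(d² − 3d + 6)/2` replaced by a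
parameter `s3b` and the hypothesis `hs3 : s₃ ≤ s3b` (next to the `4`-circuit parameter `s4b`, `hs4 : s₄ ≤ s4b`) — so that p3's
triangle table (`TriangleCap.core_ncard_triangles_le_cq3`: `s₃ ≤ 11 / 13 / 16 / 20 / 24 / 29 / 34 / 40` at `ν = 7 … 14`, against
T⁺⁺⁺ = `17 / 23 / 30 / 38 / 47 / 57 / 68 / 80`) can be used in place of T⁺⁺⁺: **`topCount_le_sharp_xqict`**. The monotonicity
in `s₃` (the polynomial side grows with `s₃`) is used with `s₃ ≤ s3b` exactly as before with `s₃ ≤ T`.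

The `(U)`-side of S2SharpCoreXQI's core as its own declaration: on the `e`-free core of rank `p` and corank `d ≥ 6` (`p ≥ 5`),
the complements of the top sets — the rank-`5` sets of `≤ d` elements — number at most
`C(n, 5) − T·C(n − 3, 2) + C(T, 2) + σ_m·(T·C(n − 3, 3) + T4⁺·C(n − 4, 2) + C(d + 4, 5)·(n − 5) + C(d + 5, 6)) + (σ_g − σ_m)·C(F_max, 6)`,
`T = (d² − 3d + 6)/2`: the partition count with the independent `5`-sets explicit (S2SetCountQI) and the triangle correction
(S2IndepFiveCount: `#{independent 5-sets} ≤ C(n, 5) − s₃·C(n − 3, 2) + C(s₃, 2)`), the circuit counts T⁺⁺⁺ / T4⁺ / `C(d + k − 1, k)`,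
and the monotonicity in `s₃ ≤ s3b` (`σ_m ≥ 1`, `C(n − 3, 2) ≤ C(n − 3, 3)`): **`topCount_le_sharp_xqict`**. Axioms: standard.
-/

open scoped Matroid

namespace PercRepro

namespace ThmN

open Set

variable {α : Type}

/-- **The top count, with the independent `5`-sets corrected by the triangles** (the `(U)`-side of
`c025_core_five_sharp_cell_xqi`, as its own declaration): on the `e`-free core of rank `p` and corank `d ≥ 6` (`p ≥ 5`),
`#U(p, 5) ≤ C(n, 5) − s3b·C(n − 3, 2) + C(s3b, 2) + σ_m·(s3b·C(n − 3, 3) + s4b·C(n − 4, 2) + C(d + 4, 5)·(n − 5) + C(d + 5, 6))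
+ (σ_g − σ_m)·C(F_max, 6)` for any `s3b ≥ s₃`, `s4b ≥ s₄`. -/
theorem topCount_le_sharp_xqict (M : Matroid α) [M.Finite] (p d : ℕ) (hd6 : 6 ≤ d) (hp5 : 5 ≤ p)
    (hR : M.eRank = (p : ℕ∞)) (hn : M.E.ncard = p + d)
    (hfree : ∀ e ∈ M.E, ∃ A ⊆ M.E \ {e}, e ∉ M.closure A ∧ e ∉ M.closure ((M.E \ {e}) \ A))
    (s3b s4b : ℕ) (hs3 : {C : Set α | M.IsCircuit C ∧ C.ncard = 3}.ncard ≤ s3b)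
    (hs4 : {C : Set α | M.IsCircuit C ∧ C.ncard = 4}.ncard ≤ s4b) :
    (Matroid.topCount M p 5 : ℚ) ≤ (((p + d).choose 5 : ℚ) -
      (s3b : ℚ) * ((p + d - 3).choose 2 : ℚ) +
        ((s3b.choose 2 : ℕ) : ℚ)) +
      (∑ j ∈ Finset.range (d - 5), (Nat.choose (min 13 ((d + 6) / 2 + 1 - 2)) j : ℚ) / (((j + 1) + 3 * (j + 1).choose 2 : ℕ) : ℚ)) *
        ((s3b * (p + d - 3).choose 3 + s4b * (p + d - 4).choose 2 +
          (d + 4).choose 5 * (p + d - 5) + (d + 5).choose 6 : ℕ) : ℚ) +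
      ((∑ j ∈ Finset.range (d - 5), (Nat.choose (min 19 (5 + d) - 6) j : ℚ) / (((j + 1) + 3 * (j + 1).choose 2 : ℕ) : ℚ)) -
        (∑ j ∈ Finset.range (d - 5), (Nat.choose (min 13 ((d + 6) / 2 + 1 - 2)) j : ℚ) / (((j + 1) + 3 * (j + 1).choose 2 : ℕ) : ℚ))) *
        ((min 19 (5 + d)).choose 6 : ℚ) := by
  classical
  have hL0 : ∀ e ∈ M.E, ¬ M.IsLoop e := not_isLoop_of_free M hfree
  have hs : ∀ e ∈ M.E, ∀ f ∈ M.E, e ≠ f → M.eRk {e, f} = 2 := by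
    intro e he f hf hef
    have h2 : (2 : ℕ∞) ≤ M.eRk {e, f} :=
      two_le_eRk_of_two_le_ncard_of_free M hfree (pair_subset he hf) (by rw [ncard_pair hef])
    have h3 : M.eRk {e, f} ≤ 2 := by
      have := M.eRk_le_encard {e, f}
      rwa [encard_pair hef] at this
    exact le_antisymm h3 h2
  have hcirc : ∀ C, M.IsCircuit C → 3 ≤ C.encard := three_le_encard_of_circuit M hL0 hs
  have hd : M.E.encard = M.eRank + d := by
    rw [hR, ← M.ground_finite.cast_ncard_eq, hn]
    push_cast
    ring
  -- the capped flat bounds: rank-`≤ 5` sets have `≤ min 19 (5 + d)` points, rank-`≤ 4` sets `≤ min 10 (4 + d)`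
  have hflat : ∀ X ⊆ M.E, M.eRk X ≤ 5 → X.ncard ≤ min 19 (5 + d) := fun X hX hr =>
    le_min (ncard_le_nineteen_of_eRk_le_five_of_free M hfree hX hr)
      (ncard_le_add_of_eRk_le_of_encard_eq M hd hX hr)
  have hflat' : ∀ X ⊆ M.E, M.eRk X ≤ ((5 - 1 : ℕ) : ℕ∞) → X.ncard ≤ min 10 (4 + d) := fun X hX hr =>
    le_min (ncard_le_ten_of_eRk_le_four_of_free M hfree hX (by simpa using hr))
      (ncard_le_add_of_eRk_le_of_encard_eq M hd hX (by simpa using hr))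
  -- the circuit counts: Lemma T, Lemma T4, and the nullity bounds
  have hC1 : ∀ L ⊆ M.E, M.eRk L = 2 → L.ncard ≤ 3 :=
    fun L hL hr => ncard_le_three_of_eRk_two M hs hfree hL hr
  have hC2 : ∀ P ⊆ M.E, M.eRk P ≤ 3 → P.ncard ≤ 6 :=
    fun P hP hr => ncard_le_six_of_eRk_le_three_of_free M hfree hP hr
  have hs5 : {C | M.IsCircuit C ∧ C.ncard = 5}.ncard ≤ (d + 4).choose 5 :=
    Matroid.ncard_circuits_le_choose_of_encard M hd 4
  have hs6 : {C | M.IsCircuit C ∧ C.ncard = 6}.ncard ≤ (d + 5).choose 6 :=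
    Matroid.ncard_circuits_le_choose_of_encard M hd 5
  -- (U): the square-multiplicity count in the PARTITION form, in `ℚ`, then the circuit bounds
  set ν₁ : ℕ := (d + 6) / 2 + 1 with hν₁
  have hU0 := S2.ncard_eRk_eq_ncard_le_le_sets_indep M 5 (min 19 (5 + d)) (min 10 (4 + d)) ν₁ 6 d (by norm_num)
    hcirc hC1 hflat hflat' (hinter_five M hfree) hd (by omega) (by omega) (by omega)
  have hU1 := Matroid.topCount_le_ncard_compl (M := M) hR hd 5
  have hm1 : min (min 19 (5 + d) - 6) (ν₁ - 2) = min 13 ((d + 6) / 2 + 1 - 2) := by omega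
  have hm3 : min (min 19 (5 + d)) (5 + d) = min 19 (5 + d) := by omega
  simp only [show (5 : ℕ) + 1 = 6 from rfl] at hU0
  rw [hn, sum_Icc_three_six_q, hm1, hm3, show d - 6 + 1 = d - 5 by omega] at hU0
  simp only [show (6 : ℕ) - 3 = 3 from rfl, show (6 : ℕ) - 4 = 2 from rfl,
    show (6 : ℕ) - 5 = 1 from rfl, show (6 : ℕ) - 6 = 0 from rfl, Nat.choose_one_right,
    Nat.choose_zero_right] at hU0
  -- the independent `5`-sets against the triangles (S2IndepFiveCount), with `s₃ ≤ T` (T⁺⁺⁺)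
  have hI5 := S2.ncard_indep_five_add_le (M := M) hC1
  rw [hn] at hI5
  have hU1q : (Matroid.topCount M p 5 : ℚ) ≤
      ({B : Set α | B ⊆ M.E ∧ M.eRk B = 5 ∧ B.ncard ≤ d}.ncard : ℚ) := by exact_mod_cast hU1
  set σm : ℚ := ∑ j ∈ Finset.range (d - 5), (Nat.choose (min 13 ((d + 6) / 2 + 1 - 2)) j : ℚ) / (((j + 1) + 3 * (j + 1).choose 2 : ℕ) : ℚ) with hσmdef
  set t := {C | M.IsCircuit C ∧ C.ncard = 3}.ncard with ht
  set T := s3b with hT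
  -- the `4`-, `5`-, `6`-circuit terms, as before
  have hsm : {C | M.IsCircuit C ∧ C.ncard = 4}.ncard * (p + d - 4).choose 2 +
      {C | M.IsCircuit C ∧ C.ncard = 5}.ncard * (p + d - 5) + {C | M.IsCircuit C ∧ C.ncard = 6}.ncard * 1 ≤
      s4b * (p + d - 4).choose 2 + (d + 4).choose 5 * (p + d - 5) + (d + 5).choose 6 := by
    have := hs6
    gcongr
    omega
  have hsmq : (({C | M.IsCircuit C ∧ C.ncard = 4}.ncard : ℚ) * ((p + d - 4).choose 2 : ℚ) +
      ({C | M.IsCircuit C ∧ C.ncard = 5}.ncard : ℚ) * ((p + d - 5 : ℕ) : ℚ) +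
      ({C | M.IsCircuit C ∧ C.ncard = 6}.ncard : ℚ) * ((1 : ℕ) : ℚ)) ≤
      ((s4b * (p + d - 4).choose 2 + (d + 4).choose 5 * (p + d - 5) + (d + 5).choose 6 : ℕ) : ℚ) := by
    exact_mod_cast hsm
  have hσm0 : (0 : ℚ) ≤ σm := Finset.sum_nonneg (fun j _ => by positivity)
  -- `σ_m ≥ 1` (the `j = 0` term) and `C(n − 3, 2) ≤ C(n − 3, 3)` (`n − 3 ≥ 5`): the polynomial side grows with `s₃`
  have hσm1 : (1 : ℚ) ≤ σm := by
    have h0 : (0 : ℕ) ∈ Finset.range (d - 5) := Finset.mem_range.2 (by omega)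
    have h := Finset.single_le_sum
      (f := fun j => (Nat.choose (min 13 ((d + 6) / 2 + 1 - 2)) j : ℚ) / (((j + 1) + 3 * (j + 1).choose 2 : ℕ) : ℚ))
      (fun j _ => by positivity) h0
    have h1 : (Nat.choose (min 13 ((d + 6) / 2 + 1 - 2)) 0 : ℚ) / (((0 + 1) + 3 * (0 + 1).choose 2 : ℕ) : ℚ) = 1 := by
      norm_num
    rw [hσmdef]
    calc (1 : ℚ) = _ := h1.symm
      _ ≤ _ := h
  have hC23 : ((p + d - 3).choose 2 : ℚ) ≤ ((p + d - 3).choose 3 : ℚ) := by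
    have h := Nat.choose_succ_right_eq (p + d - 3) 2
    have h5 : 5 ≤ p + d - 3 := by omega
    have h' : (p + d - 3).choose 2 * 3 ≤ (p + d - 3).choose 3 * 3 := by
      rw [h]
      exact Nat.mul_le_mul_left _ (by omega)
    exact_mod_cast Nat.le_of_mul_le_mul_right h' (by norm_num)
  have hbr : ((p + d - 3).choose 2 : ℚ) ≤ σm * ((p + d - 3).choose 3 : ℚ) := by
    calc ((p + d - 3).choose 2 : ℚ) ≤ ((p + d - 3).choose 3 : ℚ) := hC23
      _ = 1 * ((p + d - 3).choose 3 : ℚ) := (one_mul _).symm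
      _ ≤ σm * ((p + d - 3).choose 3 : ℚ) := mul_le_mul_of_nonneg_right hσm1 (by positivity)
  have htT : t ≤ T := hs3
  have htTq : (t : ℚ) ≤ (T : ℚ) := by exact_mod_cast htT
  have hch : ((t.choose 2 : ℕ) : ℚ) ≤ ((T.choose 2 : ℕ) : ℚ) := by
    exact_mod_cast Nat.choose_le_choose 2 htT
  have hI5q : ({B : Set α | B ⊆ M.E ∧ B.ncard = 5 ∧ M.eRk B = 5}.ncard : ℚ) ≤
      ((p + d).choose 5 : ℚ) - (t : ℚ) * ((p + d - 3).choose 2 : ℚ) + ((t.choose 2 : ℕ) : ℚ) := by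
    have h' : (({B : Set α | B ⊆ M.E ∧ B.ncard = 5 ∧ M.eRk B = 5}.ncard + t * (p + d - 3).choose 2 : ℕ) : ℚ) ≤
        (((p + d).choose 5 + t.choose 2 : ℕ) : ℚ) := by exact_mod_cast hI5
    push_cast at h'
    linarith
  have hmul := mul_le_mul_of_nonneg_right htTq (sub_nonneg.2 hbr)
  have hkey : ({B : Set α | B ⊆ M.E ∧ B.ncard = 5 ∧ M.eRk B = 5}.ncard : ℚ) +
      σm * ((t : ℚ) * ((p + d - 3).choose 3 : ℚ)) ≤
      (((p + d).choose 5 : ℚ) - (T : ℚ) * ((p + d - 3).choose 2 : ℚ) + ((T.choose 2 : ℕ) : ℚ)) +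
      σm * ((T : ℚ) * ((p + d - 3).choose 3 : ℚ)) := by
    nlinarith [hI5q, hch, hmul]
  refine hU1q.trans (hU0.trans ?_)
  have e1 := mul_le_mul_of_nonneg_left hsmq hσm0
  push_cast at e1 ⊢
  linarith [hkey, e1]

end ThmN

end PercRepro
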